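import Summits.ValiantsHypothesis.ValiantsHypothesis.Theorems.LacunarySymmetroidMatrixDescartesCensusGardingLorentz
import Mathlib.LinearAlgebra.CrossProduct

/-!
# `MatrixDescartes` census — DOOR A at `(3,4)`: the NEGATIVE CONE of the sheet form `Z ↦ tr(adj Z · S₃)` for a SINGULAR semidefinite top letter,
# and its three rows valid with NO definite letter: the PAIR LAW, the NEWTON ROW and the TRIANGLE LAW of the semidefinite cell

HONEST FRAMING.  Object-search cell `pub-symmetroid`, engine seat `val-sym-eng-2` (g5); helper rows beside the registered strata line
`Cruxes/DoorA34/Lines/strata.lean` on stmt-ValiantsHypothesis-19980 (`DoorA34 = PosRootLawAt 3 4 18`: OPEN, typed, never asserted here).  Companion of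
`…CensusGardingLorentz` (`garding_row_N3`: reverse Cauchy–Schwarz of `X ↦ tr(adj X · P)` for a positive DEFINITE `P`).  On the null-top sheet the top
letter `P = S₃` is SINGULAR; in its semidefinite cell (`S₃ ⪰ 0` or `S₃ ⪯ 0`, the cell of the kernel sixteens p619923 / p623646) the sheet form
`q(Z) = tr(adj Z · S₃)` — whose values `q(S_x)` and polarisations `m(S_x,S_y) = tr((adj(S_x+S_y) − adj S_x − adj S_y)·S₃)` ARE the six MIDDLE-window slot
coefficients `c_{3xx}`, `c_{3xy}` of `det F` (…NullTopEighteenAnatomy) — has exactly ONE positive square, and more precisely: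

* `cross_dotProduct_adjugate_mulVec_cross` — Lagrange–adjugate identity `(k×w)ᵀ adj(Z) (k×w) = (kᵀZk)(wᵀZw) − (kᵀZw)²` (symmetric `Z`);
* `dotProduct_adjugate_mulVec_nonpos_of_isotropic`, **`trace_adjugate_mul_nonpos_of_kernel_isotropic`** — THE NEGATIVE CONE: `P ⪰ 0` with kernel vector
  `k ≠ 0` and `kᵀZk = 0` ⇒ `tr(adj Z · P) ≤ 0` (the form is nonpositive on the kernel of the TOP-window functional `Z ↦ kᵀZk`, to which the top slots
  `c_{33x} = tr(adj S₃·S_x)` are proportional: `dotProduct_self_mul_trace_adjugate_mul`, `(k·k)·tr(adj P·X) = tr(adj P)·kᵀXk`);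
* **`sheet_pair_law`** / `sheet_pair_law_slots` (`S₃ ⪰ 0`) / `sheet_pair_law_slots_neg` (`S₃ ⪯ 0`) — `q(X), q(Y) > 0 ⇒ 0 < (kᵀXk)(kᵀYk)·m(X,Y)`: two POSITIVE
  square middle slots force the mixed middle slot to carry the sign of the product of the two top slots (SIGN-LEVEL row, no definite letter needed);
* **`sheet_newton_row`** (`_slots`) — `q(X) > 0 ⇒ 4·q(X)·q(Y) ≤ m(X,Y)²`: the MAGNITUDE row `c_{3xy}² ≥ 4 c_{3xx} c_{3yy}` of the semidefinite cell (reverse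
  Cauchy–Schwarz of the singular sheet form; `garding_row_N3` needs `P ≻ 0`);
* **`sheet_triangle_law`** (`_slots`) — three positive square values ⇒ the product of the three mixed values is positive (balanced middle window).

Proof route: `P = BᵀB` (C⋆-order factorisation), every row of `B` is `⊥ k`, and on `k^⊥` the adjugate form of a `k`-isotropic `Z` is `−(kᵀZw)² ≤ 0` by the
Lagrange identity with `w = k × v`; the rows follow from `q((kᵀYk)X − (kᵀXk)Y) ≤ 0`.  The application to hypothetical null-top eighteens (rank parities, the
chamber test, instances) is in `…SheetSemidefPairLaw`.  Nothing here bounds anything by itself; `DoorA34` and the three stubs stay OPEN; registers unchanged;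
nothing on `MatrixDescartes` (stmt-ValiantsHypothesis-18050) or `VP ≠ VNP` — VP≠VNP not moved.  [folklore] Lagrange identity / Schur-type factorisation of a
positive semidefinite matrix / elementary real algebra.
-/

-- `Summit.ValiantsHypothesis.ValiantsHypothesis.…` repeats a component by the D-0017 layout
-- (single-conjunct summit), which the `dupNamespace` linter flags; the name is mandated.
set_option linter.dupNamespace false

namespace Summit.ValiantsHypothesis.ValiantsHypothesis.Theorems.LacunarySymmetroidMatrixDescartes.Census

open Matrix Finset
open scoped BigOperators Matrix

/-! ## 1. The negative cone of the sheet form `Z ↦ tr(adj Z · P)` -/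

/-- **Lagrange–adjugate identity** (`3 × 3`, symmetric `Z`): `(k × w)ᵀ adj(Z) (k × w) = (kᵀZk)(wᵀZw) − (kᵀZw)²` — the value of the
adjugate form on a cross product is the Gram determinant of `Z` on the plane `⟨k, w⟩`. [folklore] -/
theorem cross_dotProduct_adjugate_mulVec_cross (Z : Matrix (Fin 3) (Fin 3) ℝ) (hZ : Z.IsSymm) (k w : Fin 3 → ℝ) :
    (k ⨯₃ w) ⬝ᵥ Z.adjugate *ᵥ (k ⨯₃ w) = (k ⬝ᵥ Z *ᵥ k) * (w ⬝ᵥ Z *ᵥ w) - (k ⬝ᵥ Z *ᵥ w) ^ 2 := by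
  have h10 : Z 1 0 = Z 0 1 := by simpa using hZ.apply 0 1
  have h20 : Z 2 0 = Z 0 2 := by simpa using hZ.apply 0 2
  have h21 : Z 2 1 = Z 1 2 := by simpa using hZ.apply 1 2
  simp only [cross_apply, Matrix.adjugate_fin_three, dotProduct, Fin.sum_univ_three, Matrix.mulVec, Matrix.of_apply,
    Matrix.cons_val', Matrix.cons_val_zero, Matrix.cons_val_one, Matrix.head_cons, Matrix.cons_val_two, Matrix.tail_cons,
    Matrix.empty_val', Matrix.cons_val_fin_one, Matrix.head_fin_const, h10, h20, h21]
  ring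

/-- **Negative cone, vector form.**  If `k ≠ 0` is ISOTROPIC for the symmetric matrix `Z` (`kᵀZk = 0`), then the adjugate form is
nonpositive on the plane `k^⊥`: `vᵀ adj(Z) v ≤ 0` for every `v ⊥ k` (indeed `(k·k)²·vᵀadj(Z)v = −(kᵀZ(k×v))²`). [folklore] -/
theorem dotProduct_adjugate_mulVec_nonpos_of_isotropic (Z : Matrix (Fin 3) (Fin 3) ℝ) (hZ : Z.IsSymm) {k v : Fin 3 → ℝ}
    (hk : k ≠ 0) (hkv : k ⬝ᵥ v = 0) (hiso : k ⬝ᵥ Z *ᵥ k = 0) : v ⬝ᵥ Z.adjugate *ᵥ v ≤ 0 := by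
  have hkk : 0 < k ⬝ᵥ k := lt_of_le_of_ne (by
      simp only [dotProduct, Fin.sum_univ_three]
      nlinarith [mul_self_nonneg (k 0), mul_self_nonneg (k 1), mul_self_nonneg (k 2)])
    (Ne.symm fun h => hk (dotProduct_self_eq_zero.mp h))
  have hcross : k ⨯₃ (k ⨯₃ v) = -((k ⬝ᵥ k) • v) := by
    rw [cross_cross_eq_smul_sub_smul', hkv, zero_smul, zero_sub]
  have key := cross_dotProduct_adjugate_mulVec_cross Z hZ k (k ⨯₃ v)
  rw [hcross, hiso, zero_mul, zero_sub] at key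
  have hscale : (-((k ⬝ᵥ k) • v)) ⬝ᵥ Z.adjugate *ᵥ (-((k ⬝ᵥ k) • v)) = (k ⬝ᵥ k) ^ 2 * (v ⬝ᵥ Z.adjugate *ᵥ v) := by
    simp only [dotProduct, Fin.sum_univ_three, Matrix.mulVec, Pi.neg_apply, Pi.smul_apply, smul_eq_mul]
    ring
  rw [hscale] at key
  have h2 : 0 < (k ⬝ᵥ k) ^ 2 := by positivity
  nlinarith [sq_nonneg (k ⬝ᵥ Z *ᵥ (k ⨯₃ v))]

/-- A diagonal entry of `B · A · Bᵀ` is the value of the form of `A` on the corresponding ROW of `B`. [folklore] -/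
theorem mul_mul_transpose_apply_diag (B A : Matrix (Fin 3) (Fin 3) ℝ) (i : Fin 3) :
    (B * A * Bᵀ) i i = B i ⬝ᵥ A *ᵥ B i := by
  simp only [Matrix.mul_apply, Matrix.transpose_apply, dotProduct, Matrix.mulVec, Fin.sum_univ_three]
  ring

/-- **NEGATIVE CONE ON THE SHEET (trace form).**  `P ⪰ 0` with a kernel vector `k ≠ 0` (`P k = 0`), `Z` symmetric and ISOTROPIC at `k`
(`kᵀZk = 0`) ⇒ `tr(adj Z · P) ≤ 0`.  (Write `P = BᵀB`; every row of `B` is `⊥ k`; sum the vector form over the rows.)  For the singular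
positive semidefinite TOP letter `P = S₃` of the null-top sheet this says: the quadratic SHEET FORM `q(Z) = tr(adj Z · S₃)` — whose values on the
lower letters and their polarisations are the six MIDDLE-window slot coefficients — is nonpositive on the hyperplane `{kᵀZk = 0}` (the kernel of the
TOP-window functional). [folklore] -/
theorem trace_adjugate_mul_nonpos_of_kernel_isotropic {P Z : Matrix (Fin 3) (Fin 3) ℝ} (hP : P.PosSemidef) {k : Fin 3 → ℝ}
    (hk : k ≠ 0) (hPk : P *ᵥ k = 0) (hZ : Z.IsSymm) (hiso : k ⬝ᵥ Z *ᵥ k = 0) : (Z.adjugate * P).trace ≤ 0 := by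
  open scoped MatrixOrder in
  obtain ⟨B, hB⟩ := CStarAlgebra.nonneg_iff_eq_star_mul_self.mp hP.nonneg
  have hBT : star B = Bᵀ := by
    rw [star_eq_conjTranspose]; exact Matrix.conjTranspose_eq_transpose_of_trivial B
  rw [hBT] at hB
  -- every row of `B` is orthogonal to `k`
  have hBk : B *ᵥ k = 0 := by
    have h0 : k ⬝ᵥ P *ᵥ k = 0 := by rw [hPk, dotProduct_zero]
    rw [hB, ← Matrix.mulVec_mulVec, Matrix.dotProduct_mulVec, Matrix.vecMul_transpose] at h0
    exact dotProduct_self_eq_zero.mp h0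
  have hrow : ∀ i, k ⬝ᵥ B i = 0 := fun i => by
    have := congrFun hBk i
    rwa [Matrix.mulVec, Pi.zero_apply, dotProduct_comm] at this
  -- `tr(adj Z · BᵀB) = tr(B · adj Z · Bᵀ) = ∑ rows`
  have htr : (Z.adjugate * P).trace = ∑ i, B i ⬝ᵥ Z.adjugate *ᵥ B i := by
    rw [hB, ← Matrix.mul_assoc, Matrix.trace_mul_comm, ← Matrix.mul_assoc, Matrix.trace]
    refine Finset.sum_congr rfl fun i _ => ?_
    rw [Matrix.diag_apply, mul_mul_transpose_apply_diag]
  rw [htr]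
  exact Finset.sum_nonpos fun i _ => dotProduct_adjugate_mulVec_nonpos_of_isotropic Z hZ hk (hrow i) hiso

/-! ## 2. The pair law, the Newton row and the triangle law of the semidefinite cell -/

/-- Polarisation of the sheet form along a two-letter combination: `tr(adj(s•B − t•A)·P) = s² q(B) − s t·m(A,B) + t² q(A)` with
`q(Z) = tr(adj Z · P)` and `m(A,B) = tr((adj(A+B) − adj A − adj B)·P)` (the MIXED slot currency of …NullTopEighteenAnatomy). [folklore] -/
theorem trace_adjugate_sub_smul_mul (A B P : Matrix (Fin 3) (Fin 3) ℝ) (s t : ℝ) :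
    ((s • B - t • A).adjugate * P).trace
      = s ^ 2 * (B.adjugate * P).trace - s * t * (((A + B).adjugate - A.adjugate - B.adjugate) * P).trace
        + t ^ 2 * (A.adjugate * P).trace := by
  simp only [Matrix.adjugate_fin_three, Matrix.trace_fin_three, Matrix.mul_apply, Fin.sum_univ_three, Matrix.sub_apply,
    Matrix.add_apply, Matrix.smul_apply, smul_eq_mul, Matrix.of_apply, Matrix.cons_val', Matrix.cons_val_zero, Matrix.cons_val_one,
    Matrix.head_cons, Matrix.cons_val_two, Matrix.tail_cons, Matrix.empty_val', Matrix.cons_val_fin_one, Matrix.head_fin_const]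
  ring

/-- The top-window functional along a two-letter combination: `kᵀ(s•B − t•A)k = s·kᵀBk − t·kᵀAk`. [folklore] -/
theorem dotProduct_sub_smul_mulVec (A B : Matrix (Fin 3) (Fin 3) ℝ) (s t : ℝ) (k : Fin 3 → ℝ) :
    k ⬝ᵥ (s • B - t • A) *ᵥ k = s * (k ⬝ᵥ B *ᵥ k) - t * (k ⬝ᵥ A *ᵥ k) := by
  simp only [dotProduct, Fin.sum_univ_three, Matrix.mulVec, Matrix.sub_apply, Matrix.smul_apply, smul_eq_mul]
  ring

/-- On the negative cone a TIMELIKE letter is not isotropic: `q(X) > 0 ⇒ kᵀXk ≠ 0`. [folklore] -/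
theorem dotProduct_mulVec_ne_zero_of_trace_adjugate_mul_pos {P X : Matrix (Fin 3) (Fin 3) ℝ} (hP : P.PosSemidef) {k : Fin 3 → ℝ}
    (hk : k ≠ 0) (hPk : P *ᵥ k = 0) (hX : X.IsSymm) (hq : 0 < (X.adjugate * P).trace) : k ⬝ᵥ X *ᵥ k ≠ 0 :=
  fun h => absurd (trace_adjugate_mul_nonpos_of_kernel_isotropic hP hk hPk hX h) (not_le.mpr hq)

/-- The basic inequality behind the pair law and the Newton row: for `P ⪰ 0` with kernel vector `k ≠ 0` and symmetric `X, Y`,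
`(kᵀYk)²·q(X) + (kᵀXk)²·q(Y) ≤ (kᵀXk)(kᵀYk)·m(X,Y)` (the combination `(kᵀYk)X − (kᵀXk)Y` is isotropic at `k`). [folklore] -/
theorem sheet_polarised_cone_inequality {P X Y : Matrix (Fin 3) (Fin 3) ℝ} (hP : P.PosSemidef) {k : Fin 3 → ℝ} (hk : k ≠ 0)
    (hPk : P *ᵥ k = 0) (hX : X.IsSymm) (hY : Y.IsSymm) :
    (k ⬝ᵥ Y *ᵥ k) ^ 2 * (X.adjugate * P).trace + (k ⬝ᵥ X *ᵥ k) ^ 2 * (Y.adjugate * P).trace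
      ≤ (k ⬝ᵥ X *ᵥ k) * (k ⬝ᵥ Y *ᵥ k) * (((X + Y).adjugate - X.adjugate - Y.adjugate) * P).trace := by
  have hZ : ((k ⬝ᵥ Y *ᵥ k) • X - (k ⬝ᵥ X *ᵥ k) • Y).IsSymm := (hX.smul _).sub (hY.smul _)
  have hiso : k ⬝ᵥ ((k ⬝ᵥ Y *ᵥ k) • X - (k ⬝ᵥ X *ᵥ k) • Y) *ᵥ k = 0 := by rw [dotProduct_sub_smul_mulVec]; ring
  have hle := trace_adjugate_mul_nonpos_of_kernel_isotropic hP hk hPk hZ hiso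
  rw [trace_adjugate_sub_smul_mul, add_comm Y X, sub_right_comm] at hle
  linarith

/-- **THE PAIR LAW OF THE SEMIDEFINITE CELL.**  `P ⪰ 0` with kernel vector `k ≠ 0`, `X, Y` symmetric with `q(X) > 0` and `q(Y) > 0`
(`q(Z) = tr(adj Z · P)`) ⇒ the mixed value has the sign of the product of the top-window values: `0 < (kᵀXk)(kᵀYk)·m(X,Y)`.  In sheet currency:
if two SQUARE middle slots `{3,x,x}`, `{3,y,y}` of a null-top pencil with `S₃ ⪰ 0` carry POSITIVE coefficients, then the MIXED middle slot `{3,x,y}` has the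
sign of the product of the two TOP slots `{3,3,x}`, `{3,3,y}`. [folklore] -/
theorem sheet_pair_law {P X Y : Matrix (Fin 3) (Fin 3) ℝ} (hP : P.PosSemidef) {k : Fin 3 → ℝ} (hk : k ≠ 0) (hPk : P *ᵥ k = 0)
    (hX : X.IsSymm) (hY : Y.IsSymm) (hqX : 0 < (X.adjugate * P).trace) (hqY : 0 < (Y.adjugate * P).trace) :
    0 < (k ⬝ᵥ X *ᵥ k) * (k ⬝ᵥ Y *ᵥ k) * (((X + Y).adjugate - X.adjugate - Y.adjugate) * P).trace := by
  have hTX := dotProduct_mulVec_ne_zero_of_trace_adjugate_mul_pos hP hk hPk hX hqX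
  have hle := sheet_polarised_cone_inequality hP hk hPk hX hY
  set TX := k ⬝ᵥ X *ᵥ k
  set TY := k ⬝ᵥ Y *ᵥ k
  have h1 : 0 < TX ^ 2 * (Y.adjugate * P).trace := mul_pos (by positivity) hqY
  have h2 : 0 ≤ TY ^ 2 * (X.adjugate * P).trace := mul_nonneg (sq_nonneg _) hqX.le
  linarith

/-- **THE NEWTON ROW OF THE SEMIDEFINITE CELL** (reverse Cauchy–Schwarz of the sheet form): `P ⪰ 0` SINGULAR (kernel vector `k ≠ 0`), `X, Y`
symmetric, `q(X) > 0` ⇒ `4·q(X)·q(Y) ≤ m(X,Y)²` — the MAGNITUDE row `c_{3xy}² ≥ 4·c_{3xx}·c_{3yy}` among the middle-window slot coefficients, valid with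
NO definite letter (companion of `garding_row_N3`, which needs `P ≻ 0`). [folklore] -/
theorem sheet_newton_row {P X Y : Matrix (Fin 3) (Fin 3) ℝ} (hP : P.PosSemidef) {k : Fin 3 → ℝ} (hk : k ≠ 0) (hPk : P *ᵥ k = 0)
    (hX : X.IsSymm) (hY : Y.IsSymm) (hqX : 0 < (X.adjugate * P).trace) :
    4 * ((X.adjugate * P).trace * (Y.adjugate * P).trace) ≤ (((X + Y).adjugate - X.adjugate - Y.adjugate) * P).trace ^ 2 := by
  have hTX := dotProduct_mulVec_ne_zero_of_trace_adjugate_mul_pos hP hk hPk hX hqX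
  have hle := sheet_polarised_cone_inequality hP hk hPk hX hY
  set TX := k ⬝ᵥ X *ᵥ k
  set TY := k ⬝ᵥ Y *ᵥ k
  set qX := (X.adjugate * P).trace
  set qY := (Y.adjugate * P).trace
  set m := (((X + Y).adjugate - X.adjugate - Y.adjugate) * P).trace
  have key : TX ^ 2 * (m ^ 2 - 4 * (qX * qY)) = (2 * qX * TY - TX * m) ^ 2 + 4 * qX * (TX * TY * m - (TY ^ 2 * qX + TX ^ 2 * qY)) := by
    ring
  have hpos : 0 < TX ^ 2 := by positivity
  have hnn : 0 ≤ TX ^ 2 * (m ^ 2 - 4 * (qX * qY)) := by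
    rw [key]; nlinarith [sq_nonneg (2 * qX * TY - TX * m), mul_nonneg (mul_nonneg (by norm_num : (0:ℝ) ≤ 4) hqX.le) (sub_nonneg.mpr hle)]
  nlinarith [(mul_nonneg_iff_of_pos_left hpos).mp hnn]

/-- **THE TRIANGLE LAW OF THE SEMIDEFINITE CELL.**  `P ⪰ 0` singular, `S₀, S₁, S₂` symmetric with all three `q(S_x) > 0` ⇒ the product of the three
mixed values is positive: `0 < m(S₀,S₁)·m(S₀,S₂)·m(S₁,S₂)` (the sign pattern of the middle window is BALANCED). [folklore] -/
theorem sheet_triangle_law {P : Matrix (Fin 3) (Fin 3) ℝ} (hP : P.PosSemidef) {k : Fin 3 → ℝ} (hk : k ≠ 0) (hPk : P *ᵥ k = 0)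
    {A B T : Matrix (Fin 3) (Fin 3) ℝ} (hA : A.IsSymm) (hB : B.IsSymm) (hT : T.IsSymm)
    (hqA : 0 < (A.adjugate * P).trace) (hqB : 0 < (B.adjugate * P).trace) (hqT : 0 < (T.adjugate * P).trace) :
    0 < (((A + B).adjugate - A.adjugate - B.adjugate) * P).trace * (((A + T).adjugate - A.adjugate - T.adjugate) * P).trace
          * (((B + T).adjugate - B.adjugate - T.adjugate) * P).trace := by
  have h1 := sheet_pair_law hP hk hPk hA hB hqA hqB
  have h2 := sheet_pair_law hP hk hPk hA hT hqA hqT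
  have h3 := sheet_pair_law hP hk hPk hB hT hqB hqT
  have hA0 := dotProduct_mulVec_ne_zero_of_trace_adjugate_mul_pos hP hk hPk hA hqA
  have hB0 := dotProduct_mulVec_ne_zero_of_trace_adjugate_mul_pos hP hk hPk hB hqB
  have hT0 := dotProduct_mulVec_ne_zero_of_trace_adjugate_mul_pos hP hk hPk hT hqT
  have h123 := mul_pos (mul_pos h1 h2) h3
  have hsq : 0 < ((k ⬝ᵥ A *ᵥ k) * (k ⬝ᵥ B *ᵥ k) * (k ⬝ᵥ T *ᵥ k)) ^ 2 := by positivity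
  have e : (k ⬝ᵥ A *ᵥ k) * (k ⬝ᵥ B *ᵥ k) * (((A + B).adjugate - A.adjugate - B.adjugate) * P).trace
      * ((k ⬝ᵥ A *ᵥ k) * (k ⬝ᵥ T *ᵥ k) * (((A + T).adjugate - A.adjugate - T.adjugate) * P).trace)
      * ((k ⬝ᵥ B *ᵥ k) * (k ⬝ᵥ T *ᵥ k) * (((B + T).adjugate - B.adjugate - T.adjugate) * P).trace)
      = ((k ⬝ᵥ A *ᵥ k) * (k ⬝ᵥ B *ᵥ k) * (k ⬝ᵥ T *ᵥ k)) ^ 2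
        * ((((A + B).adjugate - A.adjugate - B.adjugate) * P).trace * (((A + T).adjugate - A.adjugate - T.adjugate) * P).trace
          * (((B + T).adjugate - B.adjugate - T.adjugate) * P).trace) := by ring
  rw [e] at h123
  exact (pos_iff_pos_of_mul_pos h123).1 hsq

/-! ## 3. Slot currency: the top-window coefficients `tr(adj S₃ · X)` versus `kᵀXk` -/

/-- **The adjugate of a singular symmetric `3 × 3` matrix is `γ·kkᵀ` on its kernel vector**, traced against an arbitrary `X`:
`(k·k)·tr(adj P · X) = tr(adj P)·kᵀXk` whenever `P` is symmetric and `P k = 0` (polynomial identity modulo the three relations `(Pk)_i = 0`). [folklore] -/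
theorem dotProduct_self_mul_trace_adjugate_mul (P X : Matrix (Fin 3) (Fin 3) ℝ) (hP : P.IsSymm) {k : Fin 3 → ℝ} (hPk : P *ᵥ k = 0) :
    (k ⬝ᵥ k) * (P.adjugate * X).trace = P.adjugate.trace * (k ⬝ᵥ X *ᵥ k) := by
  have h10 : P 1 0 = P 0 1 := by simpa using hP.apply 0 1
  have h20 : P 2 0 = P 0 2 := by simpa using hP.apply 0 2
  have h21 : P 2 1 = P 1 2 := by simpa using hP.apply 1 2
  have g0 : P 0 0 * k 0 + P 0 1 * k 1 + P 0 2 * k 2 = 0 := by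
    have := congrFun hPk 0; simpa [Matrix.mulVec, dotProduct, Fin.sum_univ_three] using this
  have g1 : P 0 1 * k 0 + P 1 1 * k 1 + P 1 2 * k 2 = 0 := by
    have := congrFun hPk 1; simpa [Matrix.mulVec, dotProduct, Fin.sum_univ_three, h10] using this
  have g2 : P 0 2 * k 0 + P 1 2 * k 1 + P 2 2 * k 2 = 0 := by
    have := congrFun hPk 2; simpa [Matrix.mulVec, dotProduct, Fin.sum_univ_three, h20, h21] using this
  simp only [Matrix.adjugate_fin_three, Matrix.trace_fin_three, Matrix.mul_apply, Fin.sum_univ_three, dotProduct, Matrix.mulVec,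
    Matrix.of_apply, Matrix.cons_val', Matrix.cons_val_zero, Matrix.cons_val_one, Matrix.head_cons, Matrix.cons_val_two, Matrix.tail_cons,
    Matrix.empty_val', Matrix.cons_val_fin_one, Matrix.head_fin_const, h10, h20, h21]
  linear_combination (P 0 1*X 0 1*k 0 + P 0 1*X 1 0*k 0 + P 0 1*X 1 1*k 1 + P 0 1*X 1 2*k 2 + P 0 1*X 2 1*k 2 - P 0 1*X 2 2*k 1 + P 0 2*X 0 2*k 0 - P 0 2*X 1 1*k 2 + P 0 2*X 1 2*k 1 + P 0 2*X 2 0*k 0 + P 0 2*X 2 1*k 1 + P 0 2*X 2 2*k 2 - P 1 1*X 0 0*k 0 - P 1 1*X 0 2*k 2 - P 1 1*X 2 0*k 2 + P 1 1*X 2 2*k 0 + P 1 2*X 0 1*k 2 + P 1 2*X 0 2*k 1 + P 1 2*X 1 0*k 2 - P 1 2*X 1 2*k 0 + P 1 2*X 2 0*k 1 - P 1 2*X 2 1*k 0 - P 2 2*X 0 0*k 0 - P 2 2*X 0 1*k 1 - P 2 2*X 1 0*k 1 + P 2 2*X 1 1*k 0) * g0 + (-P 0 0*X 0 1*k 0 -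 P 0 0*X 1 0*k 0 - P 0 0*X 1 1*k 1 - P 0 0*X 1 2*k 2 - P 0 0*X 2 1*k 2 + P 0 0*X 2 2*k 1 + P 0 1*X 0 0*k 0 + P 0 1*X 0 2*k 2 + P 0 1*X 2 0*k 2 - P 0 1*X 2 2*k 0 - P 0 2*X 0 2*k 1 + P 0 2*X 1 2*k 0 - P 0 2*X 2 0*k 1 + P 0 2*X 2 1*k 0 - P 1 2*X 0 0*k 2 + P 1 2*X 0 2*k 0 + P 1 2*X 1 2*k 1 + P 1 2*X 2 0*k 0 + P 1 2*X 2 1*k 1 + P 1 2*X 2 2*k 2 + P 2 2*X 0 0*k 1 - P 2 2*X 0 1*k 0 - P 2 2*X 1 0*k 0 - P 2 2*X 1 1*k 1) * g1 + (-P 0 0*X 0 2*k 0 + P 0 0*X 1 1*k 2 - P 0 0*X 1 2*k 1 - P 0 0*X 2 0*k 0 - P 0 0*X 2 1*k 1 - P 0 0*X 2 2*k 2 - P 0 1*X 0 1*k 2 - P 0 1*X 1 0*k 2 + P 0 2*X 0 0*k 0 + P 0 2*X 0 1*k 1 + P 0 2*X 1 0*k 1 - P 0 2*X 1 1*k 0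 + P 1 1*X 0 0*k 2 - P 1 1*X 0 2*k 0 - P 1 1*X 1 2*k 1 - P 1 1*X 2 0*k 0 - P 1 1*X 2 1*k 1 - P 1 1*X 2 2*k 2 - P 1 2*X 0 0*k 1 + P 1 2*X 0 1*k 0 + P 1 2*X 1 0*k 0 + P 1 2*X 1 1*k 1) * g2

/-- For `3 × 3` matrices `adj(−P) = adj P`. [folklore] -/
private theorem adjugate_neg_fin_three_aux (P : Matrix (Fin 3) (Fin 3) ℝ) : (-P).adjugate = P.adjugate := by
  rw [← neg_one_smul ℝ P, Matrix.adjugate_smul]; simp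

/-- **PAIR LAW in slot currency (`S₃ ⪰ 0`).**  `P ⪰ 0` singular, `X, Y` symmetric, `tr(adj X·P) > 0`, `tr(adj Y·P) > 0`, and the top-window value
`tr(adj P·X) ≠ 0` ⇒ `0 < tr(adj P·X)·tr(adj P·Y)·tr((adj(X+Y) − adj X − adj Y)·P)` — i.e. on the null-top sheet with `S₃ ⪰ 0`: two POSITIVE square middle
slots `c_{3xx}, c_{3yy} > 0` force `sign c_{3xy} = sign(c_{33x}·c_{33y})`. [folklore] -/
theorem sheet_pair_law_slots {P X Y : Matrix (Fin 3) (Fin 3) ℝ} (hP : P.PosSemidef) (hdet : P.det = 0) (hX : X.IsSymm) (hY : Y.IsSymm)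
    (hqX : 0 < (X.adjugate * P).trace) (hqY : 0 < (Y.adjugate * P).trace) (hT : (P.adjugate * X).trace ≠ 0) :
    0 < (P.adjugate * X).trace * (P.adjugate * Y).trace * (((X + Y).adjugate - X.adjugate - Y.adjugate) * P).trace := by
  obtain ⟨k, hk, hPk⟩ := Matrix.exists_mulVec_eq_zero_iff.mpr hdet
  have hPs : P.IsSymm := isHermitian_iff_isSymm.mp hP.1
  have law := sheet_pair_law hP hk hPk hX hY hqX hqY
  have iX := dotProduct_self_mul_trace_adjugate_mul P X hPs hPk
  have iY := dotProduct_self_mul_trace_adjugate_mul P Y hPs hPk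
  have hkk : 0 < k ⬝ᵥ k := lt_of_le_of_ne (by
      simp only [dotProduct, Fin.sum_univ_three]
      nlinarith [mul_self_nonneg (k 0), mul_self_nonneg (k 1), mul_self_nonneg (k 2)])
    (Ne.symm fun h => hk (dotProduct_self_eq_zero.mp h))
  have htr : P.adjugate.trace ≠ 0 := by
    intro h0; rw [h0, zero_mul] at iX
    exact hT ((mul_eq_zero.mp iX).resolve_left hkk.ne')
  have e : ((k ⬝ᵥ k) * (P.adjugate * X).trace) * ((k ⬝ᵥ k) * (P.adjugate * Y).trace)
      * (((X + Y).adjugate - X.adjugate - Y.adjugate) * P).trace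
      = (k ⬝ᵥ k) ^ 2 * ((P.adjugate * X).trace * (P.adjugate * Y).trace * (((X + Y).adjugate - X.adjugate - Y.adjugate) * P).trace) := by
    ring
  rw [iX, iY] at e
  have lhs : 0 < P.adjugate.trace * (k ⬝ᵥ X *ᵥ k) * (P.adjugate.trace * (k ⬝ᵥ Y *ᵥ k))
      * (((X + Y).adjugate - X.adjugate - Y.adjugate) * P).trace := by
    have e2 : P.adjugate.trace * (k ⬝ᵥ X *ᵥ k) * (P.adjugate.trace * (k ⬝ᵥ Y *ᵥ k))
        * (((X + Y).adjugate - X.adjugate - Y.adjugate) * P).trace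
        = P.adjugate.trace ^ 2 * ((k ⬝ᵥ X *ᵥ k) * (k ⬝ᵥ Y *ᵥ k) * (((X + Y).adjugate - X.adjugate - Y.adjugate) * P).trace) := by ring
    rw [e2]; exact mul_pos (by positivity) law
  rw [e] at lhs
  exact (pos_iff_pos_of_mul_pos lhs).1 (by positivity)

/-- **PAIR LAW in slot currency (`S₃ ⪯ 0`).**  The mirror cell: `−P ⪰ 0` singular, two NEGATIVE square middle values ⇒ the mixed value has the sign
OPPOSITE to `c_{33x}·c_{33y}`: `tr(adj P·X)·tr(adj P·Y)·m(X,Y) < 0`. [folklore] -/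
theorem sheet_pair_law_slots_neg {P X Y : Matrix (Fin 3) (Fin 3) ℝ} (hP : (-P).PosSemidef) (hdet : P.det = 0) (hX : X.IsSymm) (hY : Y.IsSymm)
    (hqX : (X.adjugate * P).trace < 0) (hqY : (Y.adjugate * P).trace < 0) (hT : (P.adjugate * X).trace ≠ 0) :
    (P.adjugate * X).trace * (P.adjugate * Y).trace * (((X + Y).adjugate - X.adjugate - Y.adjugate) * P).trace < 0 := by
  have hdet' : (-P).det = 0 := by rw [Matrix.det_neg, hdet, mul_zero]
  have hqX' : 0 < (X.adjugate * (-P)).trace := by rw [Matrix.mul_neg, Matrix.trace_neg]; linarith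
  have hqY' : 0 < (Y.adjugate * (-P)).trace := by rw [Matrix.mul_neg, Matrix.trace_neg]; linarith
  have hT' : ((-P).adjugate * X).trace ≠ 0 := by rwa [adjugate_neg_fin_three_aux]
  have law := sheet_pair_law_slots hP hdet' hX hY hqX' hqY' hT'
  rw [adjugate_neg_fin_three_aux, Matrix.mul_neg, Matrix.trace_neg] at law
  linarith

/-- **NEWTON ROW in slot currency.**  `P ⪰ 0` singular, `X, Y` symmetric, `tr(adj X·P) > 0` ⇒ `4·tr(adj X·P)·tr(adj Y·P) ≤ m(X,Y)²` — on the null-top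
sheet with `S₃ ⪰ 0` (or, by `S ↦ −S`, `S₃ ⪯ 0`): `c_{3xy}² ≥ 4·c_{3xx}·c_{3yy}` as soon as `c_{3xx}` has the timelike sign. [folklore] -/
theorem sheet_newton_row_slots {P X Y : Matrix (Fin 3) (Fin 3) ℝ} (hP : P.PosSemidef) (hdet : P.det = 0) (hX : X.IsSymm) (hY : Y.IsSymm)
    (hqX : 0 < (X.adjugate * P).trace) :
    4 * ((X.adjugate * P).trace * (Y.adjugate * P).trace) ≤ (((X + Y).adjugate - X.adjugate - Y.adjugate) * P).trace ^ 2 := by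
  obtain ⟨k, hk, hPk⟩ := Matrix.exists_mulVec_eq_zero_iff.mpr hdet
  exact sheet_newton_row hP hk hPk hX hY hqX

/-- **TRIANGLE LAW in slot currency.**  `P ⪰ 0` singular and three symmetric letters with positive square values ⇒ the product of the three mixed values is
positive. [folklore] -/
theorem sheet_triangle_law_slots {P A B T : Matrix (Fin 3) (Fin 3) ℝ} (hP : P.PosSemidef) (hdet : P.det = 0)
    (hA : A.IsSymm) (hB : B.IsSymm) (hT : T.IsSymm)
    (hqA : 0 < (A.adjugate * P).trace) (hqB : 0 < (B.adjugate * P).trace) (hqT : 0 < (T.adjugate * P).trace) :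
    0 < (((A + B).adjugate - A.adjugate - B.adjugate) * P).trace * (((A + T).adjugate - A.adjugate - T.adjugate) * P).trace
          * (((B + T).adjugate - B.adjugate - T.adjugate) * P).trace := by
  obtain ⟨k, hk, hPk⟩ := Matrix.exists_mulVec_eq_zero_iff.mpr hdet
  exact sheet_triangle_law hP hk hPk hA hB hT hqA hqB hqT

end Summit.ValiantsHypothesis.ValiantsHypothesis.Theorems.LacunarySymmetroidMatrixDescartes.Census
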